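import Literature.Topology.FourManifolds.LargeKTrisectionClassification
import Literature.Topology.FourManifolds.ConnectedSumEulerCharacteristic
import Literature.Topology.FourManifolds.ConnectedSumSphereIdentity
import Literature.Topology.FourManifolds.ConnectedSumProofs
import Literature.Topology.FourManifolds.LinkSurgeryExistence
import Literature.Topology.FourManifolds.SmoothEmbeddingCriteria
import Literature.Topology.FourManifolds.PalaisBallComplement
import Literature.Topology.FourManifolds.TrisectionEulerProofs
import Literature.AlgebraicTopology.SingularHomology.PairTimesCircle
import Literature.Geometry.Manifold.ModelChange
import Mathlib.Analysis.SpecialFunctions.Complex.Circle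
import HarnessLib

/-!
# Connected sums of copies of `S¹ × S³`: Euler characteristic `2 − 2k`, and `#¹(S¹ × S³) ≅ S¹ × S³`

Topic `Literature/Topology/FourManifolds`, after `LargeKTrisectionClassification.lean` (the
inductive class `Literature.Topology.FourManifolds.IsCircleProdSum k P`: "`P` is a connected sum of
`k` copies of `S¹ × S³`", `#⁰ = S⁴`, the summands `Circle × 𝕊³` split off one at a time through the
relational `IsConnectedSum`).  Two consequences needed to read Meier–Schirmer–Zupan's
classification (`msz_trisection_classification_gk`) on a loop partner of a homotopy 4-sphere
(`Literature.Topology.FourManifolds.msz_loopSurgery_homotopySphere_gk`):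

* `IsCircleProdSum.finRelHomology_and_relEuler_eq` — **`χ(#ᵏ(S¹ × S³)) = 2 − 2k`** with finiteness
  of the homology (Gompf–Stipsicz 1999, §1.2: `e(M # N) = e(M) + e(N) − 2`, the tree's
  `IsConnectedSum.finRelHomology_and_relEuler_eq`; `e(S⁴) = 2`, `e(S¹ × S³) = 0`, the tree's
  `FinRelHomology.addCircle_prod`).
* `IsCircleProdSum.nonempty_diffeomorph_sphereOne_prod_sphereThree_of_one` — **a connected sum of
  ONE copy of `S¹ × S³` is diffeomorphic to `S¹ × S³`** (`#¹(S¹ × S³) = S⁴ # (S¹ × S³)`, and `Sⁿ` is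
  the identity for `#`: Kervaire–Milnor 1963, Lemma 2.1 / the tree's
  `nonempty_diffeomorph_of_isConnectedSum_sphere'`), as a diffeomorphism onto Mathlib's product
  manifold `𝕊¹ × 𝕊³` (model `(𝓡 1).prod (𝓡 3)`).

Both tree theorems invoked are stated for summands charted on `ℝ⁴`, whereas the summand
`Circle × 𝕊³` comes charted on `ModelProd ℝ¹ ℝ³`; the bridge is a transport of the connected-sum
relation along a CROSS-MODEL diffeomorphism of a summand
(`IsConnectedSum.of_diffeomorph_right_of_boundaryless`, any boundaryless models of equal finite
dimension; the same-model case is the tree's `IsConnectedSum.of_diffeomorph_right`) applied to the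
recharting of `Circle × 𝕊³` on `ℝ⁴` (`Literature.Geometry.Manifold.Rechart`,
`exists_rechart_circle_prod_sphereThree`).  Also recorded: `nonempty_diffeomorph_circle_sphereOne`
(`Circle ≅ 𝕊¹ ⊆ ℝ²`) and `finRelHomology_and_relEuler_circle_prod_sphereThree` (`χ(S¹ × S³) = 0`).

Everything is proved; no definitions, no named facts.

## References

* R. E. Gompf, A. I. Stipsicz, *4-Manifolds and Kirby Calculus*, GSM 20 (1999), §1.2.
  [GompfStipsicz1999]
* M. Kervaire, J. Milnor, *Groups of homotopy spheres I*, Ann. of Math. 77 (1963), §2, Lemma 2.1.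
  [KervaireMilnor1963]
* J. Meier, A. Zupan, *Genus-two trisections are standard*, Geom. Topol. 21 (2017), §1
  (`#⁰(S¹ × S³) = S⁴`). [MeierZupan2017]
* A. Hatcher, *Algebraic Topology* (2002), §2.2 Thm. 2.44, Cor. 2.11. [HatcherAT2002]
-/

noncomputable section

open Set Function Module
open scoped Manifold ContDiff Topology
open Literature.AlgebraicTopology.SingularHomology
open Literature.Geometry.Manifold (Rechart)

namespace Literature.Topology.FourManifolds

/-! ### Transport of a connected sum along a cross-model diffeomorphism of a summand -/

section CrossModel

variable {EP HP : Type*} [NormedAddCommGroup EP] [NormedSpace ℝ EP] [TopologicalSpace HP]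
  {IP : ModelWithCorners ℝ EP HP}
  {EM HM : Type*} [NormedAddCommGroup EM] [NormedSpace ℝ EM] [TopologicalSpace HM]
  {IM : ModelWithCorners ℝ EM HM}
  {EN HN : Type*} [NormedAddCommGroup EN] [NormedSpace ℝ EN] [TopologicalSpace HN]
  {IN : ModelWithCorners ℝ EN HN}
  {EN' HN' : Type*} [NormedAddCommGroup EN'] [NormedSpace ℝ EN'] [TopologicalSpace HN']
  {IN' : ModelWithCorners ℝ EN' HN'}
  {M N N' P : Type*} [TopologicalSpace M] [T2Space M] [ChartedSpace HM M]
  [TopologicalSpace N] [T2Space N] [ChartedSpace HN N] [TopologicalSpace N'] [T2Space N']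
  [ChartedSpace HN' N'] [TopologicalSpace P] [ChartedSpace HP P]

/-- **A connected sum `M # N` is a connected sum `M # N'` for every diffeomorphism `ψ : N ≅ N'`,
also when `N`, `N'` carry different boundaryless models** (of the dimension of the sum, identified
by `L`, `LP`): compose the disc `i₂` with `ψ` — an open smooth embedding, by the dimension count
`isOpen_range_of_isImmersion_of_finrank_le`, so the tree's cross-model composition of OPEN smooth
embeddings `isSmoothEmbedding_comp_of_isOpen_range` applies — and the embedding of the punctured
summand with the restriction `N' ∖ {ψ (i₂ 0)} ≅ N ∖ {i₂ 0}` of `ψ⁻¹` (`opensCongr`); the gluing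
relation only sees `i₂` through `ψ ∘ i₂` (Kervaire–Milnor 1963, §2, "well defined"; the same-model
case is `IsConnectedSum.of_diffeomorph_right`). [cite: KervaireMilnor1963, §2] -/
theorem IsConnectedSum.of_diffeomorph_right_of_boundaryless [IP.Boundaryless] [IN.Boundaryless]
    [IN'.Boundaryless] [IsManifold IN ∞ N] [IsManifold IN' ∞ N'] [IsManifold IP ∞ P]
    [FiniteDimensional ℝ EP] [FiniteDimensional ℝ EN] (h : IsConnectedSum IP IM IN M N P) (ψ : N ≃ₘ⟮IN, IN'⟯ N')
    (hdim : finrank ℝ EN ≤ finrank ℝ EP) (L : EN ≃L[ℝ] EN') (LP : EN ≃L[ℝ] EP) :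
    IsConnectedSum IP IM IN' M N' P := by
  obtain ⟨i₁, i₂, h₁, h₂, jA, jB, hA, hAo, hB, hBo, hU, hR⟩ := h
  -- the disc `i₂` has open range, so `ψ ∘ i₂` is a smooth embedding
  have h₂o : IsOpen (range i₂) := isOpen_range_of_isImmersion_of_finrank_le h₂.isImmersion hdim
  have hψr : range (ψ : N → N') = univ :=
    Set.eq_univ_of_forall fun x => ⟨ψ.symm x, ψ.apply_symm_apply x⟩
  have hψo : IsOpen (range (ψ : N → N')) := by
    rw [hψr]; exact isOpen_univ
  have h₂' : Manifold.IsSmoothEmbedding 𝓘(ℝ, EP) IN' ∞ (ψ ∘ i₂) :=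
    (isSmoothEmbedding_comp_of_isOpen_range (isSmoothEmbedding_diffeomorph_of_boundaryless ψ L)
      hψo h₂ h₂o (LP.symm.trans L)).1
  -- the punctured summands correspond under `ψ⁻¹`
  have hmem : ∀ b : N', b ∈ puncture (ψ ∘ i₂) ↔ ψ.symm b ∈ puncture i₂ := fun b => by
    rw [mem_puncture, mem_puncture, comp_apply]
    constructor
    · intro h h'
      exact h (by rw [← h', Diffeomorph.apply_symm_apply])
    · intro h h'
      exact h (by rw [h', Diffeomorph.symm_apply_apply])
  let κ : ↥(puncture (ψ ∘ i₂)) ≃ₘ⟮IN', IN⟯ ↥(puncture i₂) := opensCongr ψ.symm _ _ hmem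
  have hκs : Function.Surjective (fun b => κ b : _ → ↥(puncture i₂)) := κ.surjective
  have hκr : range (fun b => κ b : _ → ↥(puncture i₂)) = univ := hκs.range_eq
  have hκo : IsOpen (range (fun b => κ b : _ → ↥(puncture i₂))) := by
    rw [hκr]; exact isOpen_univ
  refine ⟨i₁, ψ ∘ i₂, h₁, h₂', jA, jB ∘ fun b => κ b, hA, hAo, ?_, ?_, ?_, fun a b => ?_⟩
  · exact (isSmoothEmbedding_comp_of_isOpen_range hB hBo
      (isSmoothEmbedding_diffeomorph_of_boundaryless κ L.symm) hκo (L.symm.trans LP)).1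
  · rwa [hκs.range_comp]
  · rwa [hκs.range_comp]
  · rw [comp_apply, hR]
    have hκb : ((κ b : ↥(puncture i₂)) : N) = ψ.symm (b : N') := rfl
    constructor
    · rintro ⟨u, t, hu, ht, ha, hb⟩
      refine ⟨u, t, hu, ht, ha, ?_⟩
      rw [hκb] at hb
      show (b : N') = ψ (i₂ ((1 - t) • u))
      rw [← hb, Diffeomorph.apply_symm_apply]
    · rintro ⟨u, t, hu, ht, ha, hb⟩
      refine ⟨u, t, hu, ht, ha, ?_⟩
      rw [hκb]
      change (b : N') = ψ (i₂ ((1 - t) • u)) at hb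
      rw [hb, Diffeomorph.symm_apply_apply]

/-- The same transport in the first summand: `M # N` is `M' # N` for a cross-model
diffeomorphism `φ : M ≅ M'` (by the symmetry of `#`). [cite: KervaireMilnor1963, §2] -/
theorem IsConnectedSum.of_diffeomorph_left_of_boundaryless
    {EM' HM' : Type*} [NormedAddCommGroup EM'] [NormedSpace ℝ EM'] [TopologicalSpace HM']
    {IM' : ModelWithCorners ℝ EM' HM'} {M' : Type*} [TopologicalSpace M'] [T2Space M']
    [ChartedSpace HM' M'] [IP.Boundaryless] [IM.Boundaryless] [IM'.Boundaryless]
    [IsManifold IM ∞ M] [IsManifold IM' ∞ M'] [IsManifold IP ∞ P] [FiniteDimensional ℝ EP]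
    [FiniteDimensional ℝ EM] (h : IsConnectedSum IP IM IN M N P) (φ : M ≃ₘ⟮IM, IM'⟯ M')
    (hdim : finrank ℝ EM ≤ finrank ℝ EP) (L : EM ≃L[ℝ] EM') (LP : EM ≃L[ℝ] EP) :
    IsConnectedSum IP IM' IN M' N P :=
  (h.symm.of_diffeomorph_right_of_boundaryless φ hdim L LP).symm

end CrossModel

/-! ### `Circle ≅ 𝕊¹`, `S¹ × S³` recharted on `ℝ⁴`, `χ(S¹ × S³) = 0` -/

/-- **The circle group is diffeomorphic to the round circle `𝕊¹ ⊆ ℝ²`**, through the isometry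
`ℂ ≃ ℝ²` (`Complex.orthonormalBasisOneI`). [folklore] -/
theorem nonempty_diffeomorph_circle_sphereOne : Nonempty (Circle ≃ₘ⟮𝓡 1, 𝓡 1⟯ (Metric.sphere (0 : EuclideanSpace ℝ (Fin 2)) 1)) := by
  haveI hC : Fact (finrank ℝ ℂ = 1 + 1) := finrank_real_complex_fact'
  haveI hE : Fact (finrank ℝ (EuclideanSpace ℝ (Fin 2)) = 1 + 1) := ⟨by simp⟩
  let φ : ℂ ≃ₗᵢ[ℝ] EuclideanSpace ℝ (Fin 2) := Complex.orthonormalBasisOneI.repr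
  have hφ : ∀ z : Circle, φ z ∈ Metric.sphere (0 : EuclideanSpace ℝ (Fin 2)) 1 := fun z => by
    rw [mem_sphere_zero_iff_norm, φ.norm_map, Circle.norm_coe]
  have hφ' : ∀ w : Metric.sphere (0 : EuclideanSpace ℝ (Fin 2)) 1,
      φ.symm w ∈ Metric.sphere (0 : ℂ) 1 := fun w => by
    rw [mem_sphere_zero_iff_norm, φ.symm.norm_map, norm_eq_of_mem_sphere w]
  let ψ : Circle ≃ₘ⟮𝓡 1, 𝓡 1⟯ (Metric.sphere (0 : EuclideanSpace ℝ (Fin 2)) 1) :=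
    { toFun := Set.codRestrict (fun z : Circle => φ z) _ hφ
      invFun := Set.codRestrict (fun w : Metric.sphere (0 : EuclideanSpace ℝ (Fin 2)) 1 =>
        φ.symm w) (Metric.sphere (0 : ℂ) 1) hφ'
      left_inv := fun z => Subtype.ext (φ.symm_apply_apply (z : ℂ))
      right_inv := fun w => Subtype.ext (φ.apply_symm_apply (w : EuclideanSpace ℝ (Fin 2)))
      contMDiff_toFun := by
        apply ContMDiff.codRestrict_sphere
        exact φ.toContinuousLinearEquiv.contDiff.contMDiff.comp contMDiff_coe_sphere
      contMDiff_invFun := by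
        apply ContMDiff.codRestrict_sphere
        exact φ.symm.toContinuousLinearEquiv.contDiff.contMDiff.comp contMDiff_coe_sphere }
  exact ⟨ψ⟩

/-- **`Circle × 𝕊³` recharted on `ℝ⁴`**: there is a compact Hausdorff `C^∞` manifold `R` charted
on `ℝ⁴` with a diffeomorphism `R ≅ Circle × 𝕊³` onto Mathlib's product manifold (the identity
map of the recharting `Rechart f (Circle × 𝕊³)` along `ℝ¹ × ℝ³ ≃L ℝ⁴`; Lee 2013, Prop. 1.17).
[folklore] -/
theorem exists_rechart_circle_prod_sphereThree :
    ∃ (R : Type) (_ : TopologicalSpace R) (_ : T2Space R) (_ : CompactSpace R)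
      (_ : ChartedSpace (EuclideanSpace ℝ (Fin 4)) R) (_ : IsManifold (𝓡 4) ∞ R),
      Nonempty (R ≃ₘ⟮𝓡 4, (𝓡 1).prod (𝓡 3)⟯ (Circle × (Metric.sphere (0 : EuclideanSpace ℝ (Fin 4)) 1))) := by
  haveI := Fact.mk (@finrank_euclideanSpace_fin ℝ _ 4)
  let L : (EuclideanSpace ℝ (Fin 1) × EuclideanSpace ℝ (Fin 3)) ≃L[ℝ]
      EuclideanSpace ℝ (Fin 4) := ContinuousLinearEquiv.ofFinrankEq (by simp)
  let f : ModelProd (EuclideanSpace ℝ (Fin 1)) (EuclideanSpace ℝ (Fin 3)) ≃ₜ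
      EuclideanSpace ℝ (Fin 4) := L.toHomeomorph
  have hIf : ∀ x, f x = L (((𝓡 1).prod (𝓡 3)) x) := fun x => rfl
  have hf :=
    Rechart.contMDiff_of_apply_eq_linear (I := (𝓡 1).prod (𝓡 3)) (n := ∞) f L hIf
  have hf' :=
    Rechart.contMDiff_symm_of_apply_eq_linear (I := (𝓡 1).prod (𝓡 3)) (n := ∞) f L hIf
  let R : Type := Rechart f (Circle × (Metric.sphere (0 : EuclideanSpace ℝ (Fin 4)) 1))
  haveI hR : IsManifold (𝓡 4) ∞ R := Rechart.isManifold f _ hf hf'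
  let Φ : R ≃ₘ⟮𝓡 4, (𝓡 1).prod (𝓡 3)⟯ (Circle × (Metric.sphere (0 : EuclideanSpace ℝ (Fin 4)) 1)) :=
    { toFun := Rechart.out f _
      invFun := Rechart.into f _
      left_inv := fun x => Rechart.into_out f _ x
      right_inv := fun x => Rechart.out_into f _ x
      contMDiff_toFun := Rechart.contMDiff_out f _ hf hf'
      contMDiff_invFun := Rechart.contMDiff_into f _ hf hf' }
  exact ⟨R, inferInstance, inferInstance, inferInstance, inferInstance, hR, ⟨Φ⟩⟩

/-- **`χ(S¹ × S³) = 0`, with finiteness** (for Mathlib's `Circle × 𝕊³`): `χ(S¹ × K) = 0` for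
every `K` of finite homological type (the tree's `FinRelHomology.addCircle_prod`, Hatcher Thm. 2.44
along the pair `(S¹ × K, arc × K)`), with `K = S³` (`finRelHomology_and_relEuler_sphere_three`)
and `ℝ/ℤ ≅ Circle` (`AddCircle.homeomorphCircle`). [cite: HatcherAT2002, §2.2 Thm. 2.44] -/
theorem finRelHomology_and_relEuler_circle_prod_sphereThree :
    FinRelHomology ℤ ℤ (Circle × (Metric.sphere (0 : EuclideanSpace ℝ (Fin 4)) 1)) ∅ 5 ∧ relEuler ℤ ℤ (Circle × (Metric.sphere (0 : EuclideanSpace ℝ (Fin 4)) 1)) ∅ = 0 := by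
  obtain ⟨h3, -⟩ := finRelHomology_and_relEuler_sphere_three
  obtain ⟨hA, hAe⟩ := FinRelHomology.addCircle_prod (R := ℤ) (M := ℤ) h3
  let e : (AddCircle (1 : ℝ) × (Metric.sphere (0 : EuclideanSpace ℝ (Fin 4)) 1)) ≃ₜ (Circle × (Metric.sphere (0 : EuclideanSpace ℝ (Fin 4)) 1)) :=
    (AddCircle.homeomorphCircle one_ne_zero).prodCongr (Homeomorph.refl _)
  refine ⟨hA.of_homeomorph e (mapsTo_empty _ _) (mapsTo_empty _ _), ?_⟩
  rw [← hAe]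
  exact (relEuler_eq_of_homeomorph (R := ℤ) (M := ℤ) (A := (∅ : Set (AddCircle (1 : ℝ) × (Metric.sphere (0 : EuclideanSpace ℝ (Fin 4)) 1))))
    e (mapsTo_empty _ _) (mapsTo_empty _ _)).symm

/-! ### `χ(#ᵏ(S¹ × S³)) = 2 − 2k` -/

/-- **The Euler characteristic of a connected sum of `k` copies of `S¹ × S³` is `2 − 2k`**, with
finiteness of the homology: `χ(S⁴) = 2` (`finRelHomology_sphere_four`), and splitting off one
summand costs `χ(S¹ × S³) − 2 = −2` (`e(M # N) = e(M) + e(N) − 2`, Gompf–Stipsicz 1999 §1.2, the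
tree's `IsConnectedSum.finRelHomology_and_relEuler_eq`, applied after recharting the summand
`Circle × 𝕊³` on `ℝ⁴`). [cite: GompfStipsicz1999, §1.2] -/
theorem IsCircleProdSum.finRelHomology_and_relEuler_eq_of_isManifold {k : ℕ} {P : Type}
    [TopologicalSpace P] [ChartedSpace (EuclideanSpace ℝ (Fin 4)) P] (h : IsCircleProdSum k P) :
    ∀ [IsManifold (𝓡 4) ∞ P], FinRelHomology ℤ ℤ P ∅ 6 ∧ relEuler ℤ ℤ P ∅ = 2 - 2 * (k : ℤ) := by
  induction h with
  | @sphere P _ _ e =>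
    intro _
    obtain ⟨hS, hSe⟩ := finRelHomology_sphere_four
    refine ⟨(hS.of_homeomorph e.toHomeomorph.symm (mapsTo_empty _ _) (mapsTo_empty _ _)).mono
      (by norm_num), ?_⟩
    rw [Nat.cast_zero, mul_zero, sub_zero, ← hSe]
    exact relEuler_eq_of_homeomorph (R := ℤ) (M := ℤ) (A := (∅ : Set P)) e.toHomeomorph
      (mapsTo_empty _ _) (mapsTo_empty _ _)
  | @succ n M P _ _ _ _ _ _ _ _ _ hM hsum ih =>
    intro _
    haveI := Fact.mk (@finrank_euclideanSpace_fin ℝ _ 4)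
    obtain ⟨-, hMe⟩ := ih
    obtain ⟨R, _, _, _, _, _, ⟨Φ⟩⟩ := exists_rechart_circle_prod_sphereThree
    -- move the summand `Circle × 𝕊³` to its copy `R` charted on `ℝ⁴`
    have hsum' : IsConnectedSum (𝓡 4) (𝓡 4) (𝓡 4) M R P :=
      hsum.of_diffeomorph_right_of_boundaryless Φ.symm (by simp)
        (ContinuousLinearEquiv.ofFinrankEq (by simp)) (ContinuousLinearEquiv.ofFinrankEq (by simp))
    obtain ⟨hP, hPe⟩ := hsum'.finRelHomology_and_relEuler_eq
    refine ⟨hP, ?_⟩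
    have hRe : relEuler ℤ ℤ R ∅ = 0 := by
      rw [← finRelHomology_and_relEuler_circle_prod_sphereThree.2]
      exact relEuler_eq_of_homeomorph (R := ℤ) (M := ℤ) (A := (∅ : Set R)) Φ.toHomeomorph
        (mapsTo_empty _ _) (mapsTo_empty _ _)
    rw [hPe, hMe, hRe]
    push_cast
    ring

/-- **The Euler characteristic of a connected sum of `k` copies of `S¹ × S³` is `2 − 2k`**, with
finiteness of the homology (`IsCircleProdSum.finRelHomology_and_relEuler_eq_of_isManifold` with the
smooth structure as an instance argument). [cite: GompfStipsicz1999, §1.2] -/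
theorem IsCircleProdSum.finRelHomology_and_relEuler_eq {k : ℕ} {P : Type} [TopologicalSpace P]
    [ChartedSpace (EuclideanSpace ℝ (Fin 4)) P] [IsManifold (𝓡 4) ∞ P] (h : IsCircleProdSum k P) :
    FinRelHomology ℤ ℤ P ∅ 6 ∧ relEuler ℤ ℤ P ∅ = 2 - 2 * (k : ℤ) :=
  h.finRelHomology_and_relEuler_eq_of_isManifold

/-- **`χ(#ᵏ(S¹ × S³) # ℂP²) = 3 − 2k`**: `e(M # ℂP²) = e(M) + 3 − 2`
(`IsConnectedSum.finRelHomology_and_relEuler_eq`, `relEuler_complexProjectivePlane`).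
[cite: GompfStipsicz1999, §1.2] -/
theorem IsCircleProdSum.relEuler_eq_of_isConnectedSum_complexProjectivePlane {k : ℕ}
    {M : Type} [TopologicalSpace M] [T2Space M] [CompactSpace M] [ChartedSpace (EuclideanSpace ℝ (Fin 4)) M]
    [IsManifold (𝓡 4) ∞ M] (hM : IsCircleProdSum k M) {P : Type} [TopologicalSpace P]
    [ChartedSpace (EuclideanSpace ℝ (Fin 4)) P] (h : IsConnectedSum (𝓡 4) (𝓡 4) (𝓡 4) M ComplexProjectivePlane P) :
    FinRelHomology ℤ ℤ P ∅ 6 ∧ relEuler ℤ ℤ P ∅ = 3 - 2 * (k : ℤ) := by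
  obtain ⟨hP, hPe⟩ := h.finRelHomology_and_relEuler_eq
  refine ⟨hP, ?_⟩
  rw [hPe, hM.finRelHomology_and_relEuler_eq.2, relEuler_complexProjectivePlane]
  ring

/-! ### `#¹(S¹ × S³) ≅ S¹ × S³` -/

/-- **A connected sum of one copy of `S¹ × S³` is diffeomorphic to `S¹ × S³`** (onto Mathlib's
product manifold `𝕊¹ × 𝕊³`): `P = M # (Circle × 𝕊³)` with `M ≅ S⁴`, so `P = S⁴ # (Circle × 𝕊³)`
(`IsConnectedSum.of_diffeomorph_left`), i.e. — after recharting the summand on `ℝ⁴`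
(`of_diffeomorph_right_of_boundaryless`) and swapping — `P = R # S⁴ ≅ R` (`Sⁿ` is the identity
for `#`, Kervaire–Milnor 1963 Lemma 2.1; the tree's `nonempty_diffeomorph_of_isConnectedSum_sphere'`),
and `R ≅ Circle × 𝕊³ ≅ 𝕊¹ × 𝕊³` (`nonempty_diffeomorph_circle_sphereOne`).
[cite: KervaireMilnor1963, §2, Lemma 2.1] [cite: MeierZupan2017, §1 ("#^0(S¹ × S³) = S⁴")] -/
theorem IsCircleProdSum.nonempty_diffeomorph_sphereOne_prod_sphereThree_of_one {P : Type}
    [TopologicalSpace P] [ChartedSpace (EuclideanSpace ℝ (Fin 4)) P] [IsManifold (𝓡 4) ∞ P] (h : IsCircleProdSum 1 P) :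
    Nonempty (P ≃ₘ⟮𝓡 4, (𝓡 1).prod (𝓡 3)⟯ ((Metric.sphere (0 : EuclideanSpace ℝ (Fin 2)) 1) × (Metric.sphere (0 : EuclideanSpace ℝ (Fin 4)) 1))) := by
  haveI := Fact.mk (@finrank_euclideanSpace_fin ℝ _ 4)
  haveI := Fact.mk (@finrank_euclideanSpace_fin ℝ _ 5)
  obtain ⟨M, _, _, _, _, _, _, _, hM, hsum⟩ := isCircleProdSum_succ_iff.mp h
  obtain ⟨e⟩ := isCircleProdSum_zero_iff.mp hM
  obtain ⟨R, _, _, _, _, _, ⟨Φ⟩⟩ := exists_rechart_circle_prod_sphereThree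
  -- `P = S⁴ # R`
  have h1 : IsConnectedSum (𝓡 4) (𝓡 4) ((𝓡 1).prod (𝓡 3)) (Metric.sphere (0 : EuclideanSpace ℝ (Fin 5)) 1) (Circle × (Metric.sphere (0 : EuclideanSpace ℝ (Fin 4)) 1)) P :=
    hsum.of_diffeomorph_left e
  have h2 : IsConnectedSum (𝓡 4) (𝓡 4) (𝓡 4) (Metric.sphere (0 : EuclideanSpace ℝ (Fin 5)) 1) R P :=
    h1.of_diffeomorph_right_of_boundaryless Φ.symm (by simp)
      (ContinuousLinearEquiv.ofFinrankEq (by simp)) (ContinuousLinearEquiv.ofFinrankEq (by simp))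
  -- `R # S⁴ ≅ R`
  obtain ⟨e'⟩ := nonempty_diffeomorph_of_isConnectedSum_sphere' h2.symm
  obtain ⟨ψ⟩ := nonempty_diffeomorph_circle_sphereOne
  exact ⟨e'.trans (Φ.trans (ψ.prodCongr (Diffeomorph.refl (𝓡 3) (Metric.sphere (0 : EuclideanSpace ℝ (Fin 4)) 1) ∞)))⟩

end Literature.Topology.FourManifolds

end
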